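import Summits.QuantumFields.YangMills.Theorems.FluctuationComparisonRegPrIntLOrganTangentTopConversion
import Summits.QuantumFields.YangMills.Theorems.FluctuationComparisonRegPrIntLOrganTangentSmallStepOneBond
import Summits.QuantumFields.BalabanUV.Beta.RemainderExplicitMarkovRate
import Literature.MathematicalPhysics.QuantumFieldTheory.Balaban1983to89.T4ExpWindowSmallField
import HarnessLib

/-!
# THE SEED H-CLAUSE, DOCKED: the frozen size-blind SEED CLAUSE + the analyticity predicate (β) at the seed height ⟹ HESSIAN-CURRENCY letters
# on the shrunk window — `runPairSeedH_of_seed`'s analytic content in the organ's own vocabulary (pen 9 of LEAD-20520 g24; spec §2∕§2b)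

Cell `ym3-torus` (YM ladder rung R3 = continuum `SU(2)` Yang–Mills on the three-torus — a RUNG, NOT d = 4, NOT infinite volume, NOT a mass
gap, NOT Clay).  LEAD-20520 width seat `ym-ust-20520-w3` (gen 24); `--supports stmt-QuantumFields-20520 --as helper`, count-neutral,
definition-free, default heartbeats; no registry, binder or `Lines/` edit (registered skeleton `Lines/semiclassical_s2beta.lean` v11.4, 0∕5,
★★OWNER RULING №36, untouched).

WHAT THIS IS.  `V18-TYPING-SPEC-w3g24.md` §2 (S2ᴴ from S2) + §2b (WINDOW MARGIN), made kernel at ONE height for ONE function `h` (the seed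
discrepancy `h_T := log ρ_T − log ρ′_T`), with the two texts the v18 typist (ideator g27) carries VERBATIM as hypotheses:
* the SIZE-BLIND SEED CLAUSE of S3 `BackwardStabilityFinSup` v17.2 (:372, frozen): for all bonds `b b′` and window configurations `U V W Z`
  forming the one-bond square, `|(h U − h V) − (h W − h Z)| ≤ ωT·e^{−κ·tdist}` (here for an abstract `h`; the typist puts `h := fun U =>
  Real.log (ρ T U) − Real.log (ρ' T U)`);
* the ANALYTICITY PREDICATE (β) = `AnalyticPairWindowAt θ r B h` of the HOME draft `O1uH_draft.lean` :79 INLINED: at every θ-window `U`,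
  bonds `b b′`, sup-norm-unit directions `w w′`, a `g : ℂ × ℂ → ℂ` complex-differentiable on the bidisc of radius `r·θ`, whose real trace is
  `h` along the two-parameter right exponential move, with oscillation `≤ B`.
CONCLUSION ★★`fourPoint_scaled_of_seed_of_analytic`: for `U` in the SHRUNK window `PlaqSmall (cH·θ)` with `cH + 6r ≤ 1` (§2b: the analytic
squares of side `3rθ∕8` per bond stay inside the θ-window — margin lemma `plaqSmall_move_move` below), unit directions `w, w′`, and move
parameters `0 ≤ s, t ≤ rθ∕4`:
`|h Z − h V − h W + h U| ≤ (K b b′·θ²)·(s∕θ)·(t∕θ)`, `K b b′ := ✓p796245's constant at `ρ := rθ`, `a := rθ∕4`, `s₁ := rθ∕8`, `r = r′ := 1∕2`,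
`σ := ωT·e^{−κ·tdist b b′}`» — i.e. `K·θ² = 800^{3∕2}·√32·6^{1∕4}·B^{3∕4}·r^{−2}·(ωT e^{−κd})^{1∕4}`, θ-UNIFORM, decay rate `κ∕4` (spec §2 «booked
cost»).  ★`hClauseSq_of_seed_of_analytic` re-states it in the draft's `HClauseSq` shape (raw moves `v, v′` of sup-norm `≤ rθ∕4`, all four
corners `cH·θ`-small): the Hessian-currency SEED LETTER.  Mechanism: ✓p796245 `abs_mixedDiff_le_scaled_of_realFourPoint_allBase` on
`g − g 0` (SUP bound `B`), whose real four-point smallness on every square based in `[0, rθ∕4]²` with side `rθ∕8` IS the seed clause at the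
translated corners (each corner is a value of the SAME `g` — the trace clause at parameters `(σ₀+s, τ₀+t)`; no subgroup law needed).

WHAT THIS IS NOT: the seed clause for the runs (S2∕S3's `RunPairSeed` ∕ `FluctuationPartSmall`, frozen №36) and (β) for the runs' densities
([Balaban1985UV3] p.263 (c)) are HYPOTHESES; nothing of Bałaban's is asserted; O1ᵘ-H∕S2ᴴ∕S3ᴴ, the five registered ∘-stubs, crux 20520
`FluctuationComparisonRegPrIntL` and `YM3TorusSU2` are NOT proved; no summit is proved by a helper.  R3 = SU(2) YM₃ on T³ — NOT d = 4, NOT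
infinite volume, NOT a mass gap, NOT Clay; the Yang–Mills mass gap is NOT proved.
-/

noncomputable section

open Function Metric Set
open Literature.MathematicalPhysics.QuantumFieldTheory.Balaban1983to89
open T4CubeChartExp (expPt toE)
open T4CubePoincare (cube mem_cube_iff)
open T4ExpWindowSmallField (plaqSmall_of_bdev_le dist1_expPt_le_of_mem_cube)
open Summit.QuantumFields.YangMills.Theorems.OrganTangentSmallStepOneBond (dist1_bdev_update_le)
open Summit.QuantumFields.YangMills.Theorems.OrganTangentTopConversion (abs_mixedDiff_le_scaled_of_realFourPoint_allBase)

namespace Summit.QuantumFields.YangMills.Theorems.OrganTangentSeedHClause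

variable {P : Params} {j : ℕ} [DecidableEq (PBond P j)]

/-! ## §1 Window margin: a right exponential move of parameter `σ` in a sup-norm-unit direction costs `4·√3·|σ|` of window -/

/-- `dist1 (expPt (σ • w)) ≤ √3·|σ|` for a sup-norm-unit direction `w`. [folklore] -/
theorem dist1_expPt_smul_le (σ : ℝ) {w : Fin 3 → ℝ} (hw : ‖w‖ ≤ 1) : dist1 (expPt (σ • w)) ≤ Real.sqrt 3 * |σ| := by
  apply dist1_expPt_le_of_mem_cube
  rw [mem_cube_iff]
  intro i
  rw [Pi.smul_apply, smul_eq_mul, abs_mul]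
  have : |w i| ≤ 1 := (norm_le_pi_norm w i).trans hw |>.trans' (le_of_eq (Real.norm_eq_abs _).symm)
  calc |σ| * |w i| ≤ |σ| * 1 := by gcongr
    _ = |σ| := mul_one _

/-- One right exponential move of parameter `σ` (unit direction) keeps a `θ₁`-small configuration `(θ₁ + 4√3|σ|)`-small
(✓`plaqSmall_of_bdev_le` ∘ ✓`dist1_bdev_update_le`). [cite: Balaban1985Averaging, (9) p.19] -/
theorem plaqSmall_move {θ₁ : ℝ} {U : GaugeField P j (Matrix.specialUnitaryGroup (Fin 2) ℂ)} (hU : PlaqSmall θ₁ U)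
    (b : PBond P j) (σ : ℝ) {w : Fin 3 → ℝ} (hw : ‖w‖ ≤ 1) :
    PlaqSmall (θ₁ + 4 * (Real.sqrt 3 * |σ|)) (update U b (U b * expPt (σ • w))) :=
  plaqSmall_of_bdev_le hU fun e => (dist1_bdev_update_le U b _ e).trans (dist1_expPt_smul_le σ hw)

/-- ★ THE MARGIN LEMMA (spec §2b): two right exponential moves of parameters `σ, τ` at bonds `b, b′` keep a `cH·θ`-small configuration
θ-small as soon as `cH·θ + 4√3(|σ| + |τ|) ≤ θ`. [cite: Balaban1985Averaging, (9) p.19] -/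
theorem plaqSmall_move_move {θ θ' : ℝ} {U : GaugeField P j (Matrix.specialUnitaryGroup (Fin 2) ℂ)} (hU : PlaqSmall θ' U)
    (b b' : PBond P j) (σ τ : ℝ) {w w' : Fin 3 → ℝ} (hw : ‖w‖ ≤ 1) (hw' : ‖w'‖ ≤ 1)
    (hroom : θ' + 4 * (Real.sqrt 3 * |σ|) + 4 * (Real.sqrt 3 * |τ|) ≤ θ) :
    PlaqSmall θ (update (update U b (U b * expPt (σ • w))) b'
      ((update U b (U b * expPt (σ • w))) b' * expPt (τ • w'))) := by
  have h1 := plaqSmall_move hU b σ hw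
  have h2 := plaqSmall_move h1 b' τ hw'
  exact fun p => lt_of_lt_of_le (h2 p) hroom

/-! ## §2 The corner configurations of the analytic square -/

/-- Corner `(σ, τ)` agrees with corner `(σ₁, τ₁)` at every bond `e` with `(e = b → σ = σ₁) ∧ (e = b′ → τ = τ₁)`. [folklore] -/
theorem corner_apply_congr (U : GaugeField P j (Matrix.specialUnitaryGroup (Fin 2) ℂ)) (b b' : PBond P j) (w w' : Fin 3 → ℝ)
    {σ τ σ₁ τ₁ : ℝ} {e : PBond P j} (hb : e = b → σ = σ₁) (hb' : e = b' → τ = τ₁) :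
    update (update U b (U b * expPt (σ • w))) b' ((update U b (U b * expPt (σ • w))) b' * expPt (τ • w')) e =
      update (update U b (U b * expPt (σ₁ • w))) b' ((update U b (U b * expPt (σ₁ • w))) b' * expPt (τ₁ • w')) e := by
  by_cases he' : e = b'
  · subst he'
    simp only [update_self]
    rw [hb' rfl]
    by_cases he : e = b
    · subst he; simp only [update_self]; rw [hb rfl]
    · simp only [update_of_ne he]
  · simp only [update_of_ne he']
    by_cases he : e = b
    · subst he; simp only [update_self]; rw [hb rfl]
    · simp only [update_of_ne he]

/-- Corner `(σ, 0)` is the one-bond move at `b` alone. [folklore] -/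
theorem corner_fst_zero (U : GaugeField P j (Matrix.specialUnitaryGroup (Fin 2) ℂ)) (b b' : PBond P j) (w w' : Fin 3 → ℝ) (σ : ℝ) :
    update (update U b (U b * expPt (σ • w))) b' ((update U b (U b * expPt (σ • w))) b' * expPt ((0 : ℝ) • w')) =
      update U b (U b * expPt (σ • w)) := by
  funext e
  rw [zero_smul, T4CubeChartExp.expPt_zero, mul_one]
  by_cases he : e = b'
  · subst he; rw [update_self]
  · rw [update_of_ne he]

/-- Corner `(0, τ)` is the one-bond move at `b′` alone. [folklore] -/
theorem corner_zero_snd (U : GaugeField P j (Matrix.specialUnitaryGroup (Fin 2) ℂ)) (b b' : PBond P j) (w w' : Fin 3 → ℝ) (τ : ℝ) :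
    update (update U b (U b * expPt ((0 : ℝ) • w))) b' ((update U b (U b * expPt ((0 : ℝ) • w))) b' * expPt (τ • w')) =
      update U b' (U b' * expPt (τ • w')) := by
  have h1 : update U b (U b * expPt ((0 : ℝ) • w)) = U := by
    funext e
    rw [zero_smul, T4CubeChartExp.expPt_zero, mul_one]
    by_cases he : e = b
    · subst he; rw [update_self]
    · rw [update_of_ne he]
  rw [h1]

/-- Corner `(0, 0)` is `U`. [folklore] -/
theorem corner_zero_zero (U : GaugeField P j (Matrix.specialUnitaryGroup (Fin 2) ℂ)) (b b' : PBond P j) (w w' : Fin 3 → ℝ) :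
    update (update U b (U b * expPt ((0 : ℝ) • w))) b' ((update U b (U b * expPt ((0 : ℝ) • w))) b' * expPt ((0 : ℝ) • w')) = U := by
  rw [corner_zero_snd]
  funext e
  rw [zero_smul, T4CubeChartExp.expPt_zero, mul_one]
  by_cases he : e = b'
  · subst he; rw [update_self]
  · rw [update_of_ne he]

/-! ## §3 The seed H-clause from the size-blind seed clause and (β) -/

/-- ★★ **THE SEED LETTER IN HESSIAN CURRENCY** (spec §2 + §2b, one height, abstract `h`).  Hypotheses: `0 < θ`, `0 < r`, `0 < B`, `0 < ωT`,
shrink factor `cH` with `cH + 6·r ≤ 1`; the SIZE-BLIND seed clause `hseed` (S3 v17.2 :372 shape) on the θ-window; the (β) clause `hβ` (draft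
`AnalyticPairWindowAt θ r B h` inlined) on the θ-window.  Conclusion: for `U` in the shrunk window `PlaqSmall (cH·θ)`, bonds `b b′`, sup-norm-unit
directions `w w′` (`‖w‖ = 1 = ‖w′‖`) and parameters `0 ≤ s, t ≤ rθ∕4`, with `V := U·e^{sw}@b`, `W := U·e^{tw′}@b′`, `Z := V·e^{tw′}@b′`:
`|h Z − h V − h W + h U| ≤ (K·θ²)·(s∕θ)·(t∕θ)`, `K` = ✓p796245's constant at `ρ = rθ, a = rθ∕4, s₁ = rθ∕8, r = r′ = 1∕2, σ = ωT·e^{−κ·tdist b b′}`.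
[cite: Balaban1985UV3, p.263] -/
theorem fourPoint_scaled_of_seed_of_analytic {θ r B ωT κ cH : ℝ} (hθ : 0 < θ) (hr : 0 < r) (hB0 : 0 < B) (hω : 0 < ωT)
    (hroom : cH + 6 * r ≤ 1)
    {h : GaugeField P j (Matrix.specialUnitaryGroup (Fin 2) ℂ) → ℝ}
    (hseed : ∀ (b b' : PBond P j) (U V W Z : GaugeField P j (Matrix.specialUnitaryGroup (Fin 2) ℂ)),
      PlaqSmall θ U → PlaqSmall θ V → PlaqSmall θ W → PlaqSmall θ Z →
      (∀ e, e ≠ b → U e = V e) → (∀ e, e ≠ b' → U e = W e) → (∀ e, e ≠ b' → V e = Z e) → (∀ e, e ≠ b → W e = Z e) →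
      |(h U - h V) - (h W - h Z)| ≤ ωT * Real.exp (-(κ * (b.src.tdist b'.src : ℝ))))
    (hβ : ∀ U : GaugeField P j (Matrix.specialUnitaryGroup (Fin 2) ℂ), PlaqSmall θ U →
      ∀ (b b' : PBond P j) (w w' : Fin 3 → ℝ), ‖w‖ ≤ 1 → ‖w'‖ ≤ 1 →
        ∃ g : ℂ × ℂ → ℂ, DifferentiableOn ℂ g (ball (0 : ℂ) (r * θ) ×ˢ ball (0 : ℂ) (r * θ)) ∧
          (∀ (s t : ℝ) (V Z : GaugeField P j (Matrix.specialUnitaryGroup (Fin 2) ℂ)), |s| < r * θ → |t| < r * θ →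
            (∀ e, e ≠ b → V e = U e) → V b = U b * expPt (s • w) → (∀ e, e ≠ b' → Z e = V e) → Z b' = V b' * expPt (t • w') →
            g ((s : ℂ), (t : ℂ)) = ((h Z : ℝ) : ℂ)) ∧
          ∀ z ∈ ball (0 : ℂ) (r * θ) ×ˢ ball (0 : ℂ) (r * θ), ‖g z - g 0‖ ≤ B)
    (U : GaugeField P j (Matrix.specialUnitaryGroup (Fin 2) ℂ)) (hU : PlaqSmall (cH * θ) U)
    (b b' : PBond P j) {w w' : Fin 3 → ℝ} (hw : ‖w‖ ≤ 1) (hw' : ‖w'‖ ≤ 1)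
    {s t : ℝ} (hs0 : 0 ≤ s) (hs : s ≤ r * θ / 4) (ht0 : 0 ≤ t) (ht : t ≤ r * θ / 4) :
    |h (update (update U b (U b * expPt (s • w))) b' ((update U b (U b * expPt (s • w))) b' * expPt (t • w'))) -
        h (update U b (U b * expPt (s • w))) - h (update U b' (U b' * expPt (t • w'))) + h U| ≤
      (25 * (2 * (4 * (3 * B) / (r * θ - r * θ / 4))) ^ (1 / 2 : ℝ) / (r * θ / 8 * (1 / 2 : ℝ) ^ 2) *
        (25 * (2 * (3 * B)) ^ (1 / 2 : ℝ) / (r * θ / 8 * (1 / 2 : ℝ) ^ 2) *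
          (ωT * Real.exp (-(κ * (b.src.tdist b'.src : ℝ)))) ^ (1 - 1 / 2 : ℝ)) ^ (1 - 1 / 2 : ℝ)) * θ ^ 2 * (s / θ) * (t / θ) := by
  have hρ : 0 < r * θ := mul_pos hr hθ
  have hcH : cH * θ ≤ θ := by
    have : cH ≤ 1 := by linarith
    calc cH * θ ≤ 1 * θ := by gcongr
      _ = θ := one_mul θ
  have hUθ : PlaqSmall θ U := fun p => lt_of_lt_of_le (hU p) hcH
  -- the analytic function of (β) at (U, b, b′, w, w′)
  obtain ⟨g, hg, htr, hosc⟩ := hβ U hUθ b b' w w' hw hw'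
  -- abbreviation for the corner configurations
  have corner_mem : ∀ σ τ : ℝ, 0 ≤ σ → σ ≤ 3 * (r * θ) / 8 → 0 ≤ τ → τ ≤ 3 * (r * θ) / 8 →
      PlaqSmall θ (update (update U b (U b * expPt (σ • w))) b' ((update U b (U b * expPt (σ • w))) b' * expPt (τ • w'))) := by
    intro σ τ hσ0 hσ hτ0 hτ
    refine plaqSmall_move_move hU b b' σ τ hw hw' ?_
    have h3 : Real.sqrt 3 < 2 := by
      rw [show (2 : ℝ) = Real.sqrt 4 by rw [show (4:ℝ) = 2^2 by norm_num, Real.sqrt_sq (by norm_num)]]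
      exact Real.sqrt_lt_sqrt (by norm_num) (by norm_num)
    rw [abs_of_nonneg hσ0, abs_of_nonneg hτ0]
    have hs3 : 0 ≤ Real.sqrt 3 := Real.sqrt_nonneg 3
    nlinarith [mul_nonneg hs3 hσ0, mul_nonneg hs3 hτ0, hθ.le, hr.le]
  -- the real trace at a corner
  have trace_at : ∀ σ τ : ℝ, 0 ≤ σ → σ ≤ 3 * (r * θ) / 8 → 0 ≤ τ → τ ≤ 3 * (r * θ) / 8 →
      g ((σ : ℂ), (τ : ℂ)) =
        ((h (update (update U b (U b * expPt (σ • w))) b' ((update U b (U b * expPt (σ • w))) b' * expPt (τ • w'))) : ℝ) : ℂ) := by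
    intro σ τ hσ0 hσ hτ0 hτ
    refine htr σ τ (update U b (U b * expPt (σ • w))) _ ?_ ?_ (fun e he => update_of_ne he _ _) (update_self _ _ _)
      (fun e he => update_of_ne he _ _) (update_self _ _ _)
    · rw [abs_of_nonneg hσ0]; linarith
    · rw [abs_of_nonneg hτ0]; linarith
  -- the normalised function g' := g − g 0
  have hg' : DifferentiableOn ℂ (fun p : ℂ × ℂ => g p - g 0) (ball (0 : ℂ) (r * θ) ×ˢ ball (0 : ℂ) (r * θ)) :=
    hg.sub (differentiableOn_const _)
  have hB' : ∀ p ∈ ball (0 : ℂ) (r * θ) ×ˢ ball (0 : ℂ) (r * θ), ‖g p - g 0‖ ≤ B := hosc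
  -- real four-point smallness on every square based in [0, rθ/4]², side rθ/8: the seed clause at the translated corners
  have hσ4 : ∀ σ₀ τ₀ : ℝ, 0 ≤ σ₀ → σ₀ ≤ r * θ / 4 → 0 ≤ τ₀ → τ₀ ≤ r * θ / 4 → ∀ s' t' : ℝ, 0 ≤ s' → s' ≤ r * θ / 8 → 0 ≤ t' → t' ≤ r * θ / 8 →
      ‖((fun p : ℂ × ℂ => g p - g 0) ((σ₀ : ℂ) + (s' : ℂ), (τ₀ : ℂ) + (t' : ℂ)) -
          (fun p : ℂ × ℂ => g p - g 0) ((σ₀ : ℂ) + (s' : ℂ), (τ₀ : ℂ)) -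
          (fun p : ℂ × ℂ => g p - g 0) ((σ₀ : ℂ), (τ₀ : ℂ) + (t' : ℂ)) +
          (fun p : ℂ × ℂ => g p - g 0) ((σ₀ : ℂ), (τ₀ : ℂ)))‖ ≤ ωT * Real.exp (-(κ * (b.src.tdist b'.src : ℝ))) := by
    intro σ₀ τ₀ hσ₀ hσ₀a hτ₀ hτ₀a s' t' hs'0 hs'1 ht'0 ht'1
    have e1 : ((σ₀ : ℂ) + (s' : ℂ)) = ((σ₀ + s' : ℝ) : ℂ) := by push_cast; ring
    have e2 : ((τ₀ : ℂ) + (t' : ℂ)) = ((τ₀ + t' : ℝ) : ℂ) := by push_cast; ring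
    simp only [e1, e2]
    have hA := trace_at σ₀ τ₀ hσ₀ (by linarith) hτ₀ (by linarith)
    have hBv := trace_at (σ₀ + s') τ₀ (by linarith) (by linarith) hτ₀ (by linarith)
    have hCv := trace_at σ₀ (τ₀ + t') hσ₀ (by linarith) (by linarith) (by linarith)
    have hDv := trace_at (σ₀ + s') (τ₀ + t') (by linarith) (by linarith) (by linarith) (by linarith)
    rw [hA, hBv, hCv, hDv]
    -- the seed square at base (σ₀, τ₀)
    have key := hseed b b'
      (update (update U b (U b * expPt (σ₀ • w))) b' ((update U b (U b * expPt (σ₀ • w))) b' * expPt (τ₀ • w')))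
      (update (update U b (U b * expPt ((σ₀ + s') • w))) b' ((update U b (U b * expPt ((σ₀ + s') • w))) b' * expPt (τ₀ • w')))
      (update (update U b (U b * expPt (σ₀ • w))) b' ((update U b (U b * expPt (σ₀ • w))) b' * expPt ((τ₀ + t') • w')))
      (update (update U b (U b * expPt ((σ₀ + s') • w))) b'
        ((update U b (U b * expPt ((σ₀ + s') • w))) b' * expPt ((τ₀ + t') • w')))
      (corner_mem σ₀ τ₀ hσ₀ (by linarith) hτ₀ (by linarith))
      (corner_mem (σ₀ + s') τ₀ (by linarith) (by linarith) hτ₀ (by linarith))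
      (corner_mem σ₀ (τ₀ + t') hσ₀ (by linarith) (by linarith) (by linarith))
      (corner_mem (σ₀ + s') (τ₀ + t') (by linarith) (by linarith) (by linarith) (by linarith))
      (fun e he => corner_apply_congr U b b' w w' (fun h' => absurd h' he) (fun _ => rfl))
      (fun e he => corner_apply_congr U b b' w w' (fun _ => rfl) (fun h' => absurd h' he))
      (fun e he => corner_apply_congr U b b' w w' (fun _ => rfl) (fun h' => absurd h' he))
      (fun e he => corner_apply_congr U b b' w w' (fun h' => absurd h' he) (fun _ => rfl))
    have hcast : ((((h (update (update U b (U b * expPt ((σ₀ + s') • w))) b'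
        ((update U b (U b * expPt ((σ₀ + s') • w))) b' * expPt ((τ₀ + t') • w'))) : ℝ) : ℂ) - g 0) -
        (((h (update (update U b (U b * expPt ((σ₀ + s') • w))) b'
          ((update U b (U b * expPt ((σ₀ + s') • w))) b' * expPt (τ₀ • w'))) : ℝ) : ℂ) - g 0) -
        (((h (update (update U b (U b * expPt (σ₀ • w))) b'
          ((update U b (U b * expPt (σ₀ • w))) b' * expPt ((τ₀ + t') • w'))) : ℝ) : ℂ) - g 0) +
        (((h (update (update U b (U b * expPt (σ₀ • w))) b'
          ((update U b (U b * expPt (σ₀ • w))) b' * expPt (τ₀ • w'))) : ℝ) : ℂ) - g 0)) =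
      (((h (update (update U b (U b * expPt (σ₀ • w))) b' ((update U b (U b * expPt (σ₀ • w))) b' * expPt (τ₀ • w'))) -
        h (update (update U b (U b * expPt ((σ₀ + s') • w))) b' ((update U b (U b * expPt ((σ₀ + s') • w))) b' * expPt (τ₀ • w'))) -
        (h (update (update U b (U b * expPt (σ₀ • w))) b' ((update U b (U b * expPt (σ₀ • w))) b' * expPt ((τ₀ + t') • w'))) -
          h (update (update U b (U b * expPt ((σ₀ + s') • w))) b'
            ((update U b (U b * expPt ((σ₀ + s') • w))) b' * expPt ((τ₀ + t') • w')))) : ℝ) : ℂ)) := by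
      push_cast; ring
    rw [hcast, Complex.norm_real, Real.norm_eq_abs]
    exact key
  have hs₁ : 0 < r * θ / 8 := by positivity
  have haρ : r * θ / 4 + r * θ / 8 * Real.cosh 1 < r * θ := by
    have hc := Summit.QuantumFields.BalabanUV.Beta.RemainderExplicitMarkovRate.cosh_one_lt_three
    nlinarith
  have hσpos : 0 < ωT * Real.exp (-(κ * (b.src.tdist b'.src : ℝ))) := mul_pos hω (Real.exp_pos _)
  -- apply TopConversion to g' at the probe (s, t)
  have key := abs_mixedDiff_le_scaled_of_realFourPoint_allBase (g := fun p : ℂ × ℂ => g p - g 0) (ρ := r * θ) (B := B)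
    hg' hB' hB0 hs₁ haρ hσ4 hσpos (r := 1 / 2) (r' := 1 / 2) (by norm_num) (by norm_num) (by norm_num) (by norm_num)
    hθ hs0 hs ht0 ht (by linarith)
    (fZ := h (update (update U b (U b * expPt (s • w))) b' ((update U b (U b * expPt (s • w))) b' * expPt (t • w'))) - h U)
    (fV := h (update U b (U b * expPt (s • w))) - h U) (fW := h (update U b' (U b' * expPt (t • w'))) - h U) (fU := 0)
    ?_ ?_ ?_ ?_
  · have : h (update (update U b (U b * expPt (s • w))) b' ((update U b (U b * expPt (s • w))) b' * expPt (t • w'))) -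
        h (update U b (U b * expPt (s • w))) - h (update U b' (U b' * expPt (t • w'))) + h U =
        (h (update (update U b (U b * expPt (s • w))) b' ((update U b (U b * expPt (s • w))) b' * expPt (t • w'))) - h U) -
        (h (update U b (U b * expPt (s • w))) - h U) - (h (update U b' (U b' * expPt (t • w'))) - h U) + 0 := by ring
    rw [this]
    exact key
  -- the four corner identities for g'
  · -- Z : corner (s, t), and g 0 = h U
    have hZ := trace_at s t hs0 (by linarith) ht0 (by linarith)
    have g00 : g 0 = ((h U : ℝ) : ℂ) := by
      have h0 := trace_at 0 0 le_rfl (by positivity) le_rfl (by positivity)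
      rw [corner_zero_zero] at h0
      rw [← Prod.mk_zero_zero]
      simpa using h0
    show g ((s : ℂ), (t : ℂ)) - g 0 = _
    rw [hZ, g00]; push_cast; ring
  · -- V : corner (s, 0)
    have hV := trace_at s 0 hs0 (by linarith) le_rfl (by positivity)
    rw [corner_fst_zero] at hV
    have g00 : g 0 = ((h U : ℝ) : ℂ) := by
      have h0 := trace_at 0 0 le_rfl (by positivity) le_rfl (by positivity)
      rw [corner_zero_zero] at h0
      rw [← Prod.mk_zero_zero]
      simpa using h0
    show g ((s : ℂ), 0) - g 0 = _
    rw [← Complex.ofReal_zero, hV, g00]; push_cast; ring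
  · -- W : corner (0, t)
    have hW := trace_at 0 t le_rfl (by positivity) ht0 (by linarith)
    rw [corner_zero_snd] at hW
    have g00 : g 0 = ((h U : ℝ) : ℂ) := by
      have h0 := trace_at 0 0 le_rfl (by positivity) le_rfl (by positivity)
      rw [corner_zero_zero] at h0
      rw [← Prod.mk_zero_zero]
      simpa using h0
    show g (0, (t : ℂ)) - g 0 = _
    rw [← Complex.ofReal_zero, hW, g00]; push_cast; ring
  · -- U : corner (0, 0)
    show g (0, 0) - g 0 = _
    rw [Prod.mk_zero_zero, sub_self, Complex.ofReal_zero]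

/-- A nonzero vector is its sup-norm times a sup-norm-unit direction. [folklore] -/
theorem smul_normalize_eq {v : Fin 3 → ℝ} (hv : v ≠ 0) : ‖v‖ • (‖v‖⁻¹ • v) = v := by
  rw [smul_smul, mul_inv_cancel₀ (norm_ne_zero_iff.mpr hv), one_smul]

/-- The sup-norm-unit direction has norm `≤ 1`. [folklore] -/
theorem norm_normalize_le {v : Fin 3 → ℝ} (hv : v ≠ 0) : ‖‖v‖⁻¹ • v‖ ≤ 1 := by
  rw [norm_smul, norm_inv, norm_norm, inv_mul_cancel₀ (norm_ne_zero_iff.mpr hv)]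

/-- A configuration agreeing with `U` off `b` and equal to `U b * g` at `b` IS `update U b (U b * g)`. [folklore] -/
theorem eq_update_of_rel {U V : GaugeField P j (Matrix.specialUnitaryGroup (Fin 2) ℂ)} {b : PBond P j}
    {g : Matrix.specialUnitaryGroup (Fin 2) ℂ} (hoff : ∀ e, e ≠ b → V e = U e) (hb : V b = U b * g) :
    V = update U b (U b * g) := by
  funext e
  by_cases he : e = b
  · subst he; rw [update_self, hb]
  · rw [update_of_ne he, hoff e he]

/-- ★ **THE DRAFT's `HClauseSq` SHAPE** (raw moves `v, v′` of sup-norm `≤ rθ∕4`; all four corners quantified with the relational square of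
`O1uH_draft.lean` :47; shrunk window `cH·θ`): `|h Z − h V − h W + h U| ≤ (K b b′·θ²)·(‖v‖∕θ)·(‖v′‖∕θ)` — from ★★`fourPoint_scaled_of_seed_of_analytic`
with `w := ‖v‖⁻¹ • v`, `s := ‖v‖` (the degenerate moves `v = 0` ∕ `v′ = 0` give `0 ≤ 0`). [cite: Balaban1985UV3, p.263] -/
theorem hClauseSq_of_seed_of_analytic {θ r B ωT κ cH : ℝ} (hθ : 0 < θ) (hr : 0 < r) (hB0 : 0 < B) (hω : 0 < ωT)
    (hroom : cH + 6 * r ≤ 1)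
    {h : GaugeField P j (Matrix.specialUnitaryGroup (Fin 2) ℂ) → ℝ}
    (hseed : ∀ (b b' : PBond P j) (U V W Z : GaugeField P j (Matrix.specialUnitaryGroup (Fin 2) ℂ)),
      PlaqSmall θ U → PlaqSmall θ V → PlaqSmall θ W → PlaqSmall θ Z →
      (∀ e, e ≠ b → U e = V e) → (∀ e, e ≠ b' → U e = W e) → (∀ e, e ≠ b' → V e = Z e) → (∀ e, e ≠ b → W e = Z e) →
      |(h U - h V) - (h W - h Z)| ≤ ωT * Real.exp (-(κ * (b.src.tdist b'.src : ℝ))))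
    (hβ : ∀ U : GaugeField P j (Matrix.specialUnitaryGroup (Fin 2) ℂ), PlaqSmall θ U →
      ∀ (b b' : PBond P j) (w w' : Fin 3 → ℝ), ‖w‖ ≤ 1 → ‖w'‖ ≤ 1 →
        ∃ g : ℂ × ℂ → ℂ, DifferentiableOn ℂ g (ball (0 : ℂ) (r * θ) ×ˢ ball (0 : ℂ) (r * θ)) ∧
          (∀ (s t : ℝ) (V Z : GaugeField P j (Matrix.specialUnitaryGroup (Fin 2) ℂ)), |s| < r * θ → |t| < r * θ →
            (∀ e, e ≠ b → V e = U e) → V b = U b * expPt (s • w) → (∀ e, e ≠ b' → Z e = V e) → Z b' = V b' * expPt (t • w') →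
            g ((s : ℂ), (t : ℂ)) = ((h Z : ℝ) : ℂ)) ∧
          ∀ z ∈ ball (0 : ℂ) (r * θ) ×ˢ ball (0 : ℂ) (r * θ), ‖g z - g 0‖ ≤ B)
    (b b' : PBond P j) (v v' : Fin 3 → ℝ) (U V W Z : GaugeField P j (Matrix.specialUnitaryGroup (Fin 2) ℂ))
    (hv : ‖v‖ ≤ r * θ / 4) (hv' : ‖v'‖ ≤ r * θ / 4) (hU : PlaqSmall (cH * θ) U)
    (_hV : PlaqSmall (cH * θ) V) (_hW : PlaqSmall (cH * θ) W) (_hZ : PlaqSmall (cH * θ) Z)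
    (hVU : ∀ e, e ≠ b → V e = U e) (hVb : V b = U b * expPt v) (hWU : ∀ e, e ≠ b' → W e = U e) (hWb : W b' = U b' * expPt v')
    (hZV : ∀ e, e ≠ b' → Z e = V e) (hZb : Z b' = V b' * expPt v') :
    |h Z - h V - h W + h U| ≤
      (25 * (2 * (4 * (3 * B) / (r * θ - r * θ / 4))) ^ (1 / 2 : ℝ) / (r * θ / 8 * (1 / 2 : ℝ) ^ 2) *
        (25 * (2 * (3 * B)) ^ (1 / 2 : ℝ) / (r * θ / 8 * (1 / 2 : ℝ) ^ 2) *
          (ωT * Real.exp (-(κ * (b.src.tdist b'.src : ℝ)))) ^ (1 - 1 / 2 : ℝ)) ^ (1 - 1 / 2 : ℝ)) * θ ^ 2 * (‖v‖ / θ) * (‖v'‖ / θ) := by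
  have hVeq := eq_update_of_rel hVU hVb
  have hWeq := eq_update_of_rel hWU hWb
  have hZeq := eq_update_of_rel hZV hZb
  -- degenerate moves
  by_cases hv0 : v = 0
  · have hVU' : V = U := by
      rw [hVeq]; funext e; by_cases he : e = b
      · subst he; rw [update_self, hv0, T4CubeChartExp.expPt_zero, mul_one]
      · rw [update_of_ne he]
    have hZW : Z = W := by
      rw [hZeq, hWeq, hVU']
    rw [hZW, hVU', hv0, norm_zero, zero_div]
    simp
  by_cases hv0' : v' = 0
  · have hWU' : W = U := by
      rw [hWeq]; funext e; by_cases he : e = b'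
      · subst he; rw [update_self, hv0', T4CubeChartExp.expPt_zero, mul_one]
      · rw [update_of_ne he]
    have hZV' : Z = V := by
      rw [hZeq]; funext e; by_cases he : e = b'
      · subst he; rw [update_self, hv0', T4CubeChartExp.expPt_zero, mul_one]
      · rw [update_of_ne he]
    rw [hZV', hWU', hv0', norm_zero, zero_div]
    simp
  -- normalise the directions
  set w : Fin 3 → ℝ := ‖v‖⁻¹ • v with hw_def
  set w' : Fin 3 → ℝ := ‖v'‖⁻¹ • v' with hw'_def
  have hw : ‖w‖ ≤ 1 := norm_normalize_le hv0
  have hw' : ‖w'‖ ≤ 1 := norm_normalize_le hv0'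
  have hsv : ‖v‖ • w = v := smul_normalize_eq hv0
  have htv : ‖v'‖ • w' = v' := smul_normalize_eq hv0'
  have key := fourPoint_scaled_of_seed_of_analytic hθ hr hB0 hω hroom hseed hβ U hU b b' hw hw'
    (norm_nonneg v) hv (norm_nonneg v') hv'
  rw [hsv, htv] at key
  rw [hZeq, hVeq, hWeq]
  exact key

end Summit.QuantumFields.YangMills.Theorems.OrganTangentSeedHClause

end
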